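import Mathlib
import HarnessLib
import Summits.HubbardSuperconductivity.HubbardSuperconductivity.Theorems.KLProgrammeKLRegimeEngineGeneralStepPrivStepOfPosPureC2
import Summits.HubbardSuperconductivity.HubbardSuperconductivity.Theorems.KLProgrammeKLRegimeCountertermJacksonRemainderCertAnFitKlEng
import Summits.HubbardSuperconductivity.HubbardSuperconductivity.Theorems.KLProgrammeKLRegimeCountertermJacksonRemainderReadResidueC1TabFitA
import Summits.HubbardSuperconductivity.HubbardSuperconductivity.Theorems.KLProgrammeKLRegimeSplitGenericV3

/-!
# K3 gen-8-FLOW (stmt 20437, stub (C) `stub_twoLeg_curvature`): «(P)-STEP-ALL-DOORS» — the private two-conjunct induction step at a GENERAL scale with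
# ALL THREE residue brackets (B), (C2), (C1) DISCHARGED BY NAME, at stub (C)'s own binders (cell gate-hubbard-kl, seat p2 g23)

= `twoLegReadPriv_flow_succ_of_pos_pure_c2_sharp` (this seat: p658457 ∘ «(C2)-ONE-CALL») ∘ the (C1) door keyed on the induction hypothesis:
* §1 **`twoLegReadPriv_flow_succ_deep`** (`5 ≤ m`): (C1) := k3c3-p3's analytic branch `readResidueC1_hJ_analytic_klEng` (window certificate `KlwjCertA` as a
  hypothesis; tables `eJ := klC1AnFit cc`, `eJ′ := klC1AnFit' cc cc'`; `IsKLRegime U c (−(m+1))` from `isKLRegime_of_le_nScales_succ`);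
* §2 **`twoLegReadPriv_flow_succ_table`** (`m + 1 ≤ 21`): (C1) := k3c3-p1's table branch `readResidueC1_hJ_of_twoLegReadJetBound_klEng` (cutoff-defect
  certificate `CutoffDefectCertFrame (klFlowDeg m) A T`, `A ≥ 10⁻¹²` — all six kit records), read below any `eJ, eJ′` above its linear forms (`curveJetBar_mono_at`).
Both at STUB (C)'s BINDERS `R.WF`, `0 < c ≤ klEngC₃6 P R`, `0 < U ≤ klEngU₀9 P R c` (the curve-regime thresholds follow: `klEngC₃6 ≤ klEngC₃3 ≤ klCurveC3`,
`klEngU₀9 ≤ klEngU₀3 ≤ klCurveU0 ≤ 1`).  WHAT THE (C)/(P) CLOSER FEEDS PER SCALE `m` (everything else is by name): the volume guard `4·klFlowDeg(m+1) ≤ L`,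
`FrameOK` of `K_m`/`K_{m+1}` at depths `≤ m`, `hZ₂/hZ`, the flow history `FlowPieceJetsAt`/`TwoLegReadJetsF` below a horizon `n ≥ m`, the (B) envelopes
`W Ξ Θ`/`hdoor`/`klEngL₄ ≤ L`/`30 ≤ s`, E1's β-free constants (pure four-leg `cN`, two-leg `cS cSs cE cEs`, the #17 export `z`), the (B) budget table `X`, the
(C2) rows `mT` + primed table `eT′`, the certificate of the branch, the INDUCTION HYPOTHESIS `TwoLegReadJetBound L M cc cc′ … K_m m` (jets half of `IHpriv m`),
(A) `hA/hAval` (c4a-1), and the three PRIVATE FITS — e.g. (deep) `cA k + klC1AnFit cc k ≤ cc k`, `cA′ k + (eB′ k + eT′ k + klC1AnFit′ cc cc′ k) ≤ cc′ k`,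
`a + (X 0 + eT′ 0 + klC1AnFit′ cc cc′ 0) ≤ x₀/2` (k3c3-p1's self-coupling recursion, memo C1-HIST-C4 §3d).  OUTPUT: `IHpriv (m+1)` =
`TwoLegReadJetBound L M cc cc′ … K_{m+1} (m+1) ∧ TwoLegReadOscAt L M x₀ … K_{m+1} (m+1)`.  With k3c3-p1's base `twoLegReadPriv_zero`, this seat's last index
`twoLegRead_flow_last_registered_of_pos_c2` and the driver `twoLegRead_registered_all`, stub (C) v2's registered pair is BY NAME modulo: (A) at every index,
E1's constants/exports, the certificates, and numeric fits.

Compositions only; no definitions; certificates, exports and history are hypotheses; nothing here asserts any stub of 20437, K3, the margin or superconductivity.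
References: BGM 2006 §2.4 Lemma 2.1 (2.36)–(2.42) [cite: BenfattoGiulianiMastropietro2006]; FST 1996 §1 [cite: FeldmanSalmhoferTrubowitz1996].
-/

noncomputable section

namespace Summit.HubbardSuperconductivity.HubbardSuperconductivity.Theorems.EngineV8

set_option linter.dupNamespace false -- summit = problem name (single-conjunct summit), D-0017
set_option exponentiation.threshold 1024 -- `2^200` literal in the budget expressions

open Complex Real Finset Filter Literature.MathematicalPhysics.QuantumLattice Literature.Probability.LatticeModels GrassmannAlgebra
open Literature.MathematicalPhysics.QuantumLattice.BandSectorCounting Literature.MathematicalPhysics.QuantumLattice.FermiRG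
open Summit.HubbardSuperconductivity.HubbardSuperconductivity.Theorems.KLRegimeSplit
open Summit.HubbardSuperconductivity.HubbardSuperconductivity.Theorems.DispersionFlow
open Summit.HubbardSuperconductivity.HubbardSuperconductivity.Theorems.KLProgrammeLegKernels
open Summit.HubbardSuperconductivity.HubbardSuperconductivity.Theorems.PerturbedFermiCurve
open scoped Nat

section AllDoors

variable {L M : ℕ} [NeZero L] [NeZero M]

/-! ## §1 Deep scales: the analytic (C1) branch -/

/-- **«(P)-STEP-DEEP» — the private (P)-step at a DEEP general scale `5 ≤ m`, `m + 1 ≤ n_β`, with (B), (C2) AND (C1) discharged by name**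
((C1) = k3c3-p3's analytic branch `readResidueC1_hJ_analytic_klEng`, matrix `klC1AnFit`; the KL-regime clause at the reading scale is discharged by
`isKLRegime_of_le_nScales_succ`).  See the module docstring. [cite: BenfattoGiulianiMastropietro2006, §2.4 Lemma 2.1 (2.36)–(2.42)] -/
theorem twoLegReadPriv_flow_succ_deep {P : SplitConsts} {R : RenConsts} (hRW : R.WF) {c : ℝ} (hc : 0 < c) (hc6 : c ≤ klEngC₃6 P R)
    {U : ℝ} (hU : 0 < U) (hU9 : U ≤ klEngU₀9 P R c) {β : ℝ} (hβmin : klBetaMin ≤ β) (hβc : β ≤ Real.exp (c / U ^ 2))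
    {μ : ℝ} (hμ : μ ∈ klWindowC) (m : ℕ) (hm5 : 5 ≤ m) (hm1 : m + 1 ≤ nScales β)
    {G : GeoConsts} {Q : EngConsts} (hGS : ∀ k, 0 ≤ G.S k) (hQS : ∀ k, 0 ≤ Q.S' k)
    {Nf₁ N : ℕ} (hOK₁ : FrameOK R U Nf₁ μ (klFlowFrameU L M β U μ m)) (hN₁ : Nf₁ ≤ m) (hOK₂ : FrameOK R U N μ (klFlowFrameU L M β U μ (m + 1))) (hNn : N ≤ m)
    (hZ₂ : IsUnit (effPartitionFn ℂ (normalCovariance L M (uvSymbolCT L M β μ (klFlowFrameU L M β U μ (m + 1)) (klScale klE0 m))) (hubbardInteraction L M β U + counterQuadratic L M β (klFlowFrameU L M β U μ (m + 1)))))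
    (hZ : ∀ t ∈ Set.Icc (0 : ℝ) 1, effPartitionFn ℂ
      (normalCovariance L M (uvSymbolCT L M β μ (klFlowFrameU L M β U μ m) (klScale klE0 m)) + ((t : ℂ)) • (normalCovariance L M (fun ks => uvSymbolCT L M β μ (klFlowFrameU L M β U μ (m + 1)) (klScale klE0 m) ks / (1 + uvSymbolCT L M β μ (klFlowFrameU L M β U μ (m + 1)) (klScale klE0 m) ks * (((fsub (klFlowFrameU L M β U μ (m + 1)) (klFlowFrameU L M β U μ m)).eval (latticeMomentum L ks.1.2) / (β * (L : ℝ) ^ 2) : ℝ) : ℂ))) - normalCovariance L M (uvSymbolCT L M β μ (klFlowFrameU L M β U μ m) (klScale klE0 m)))) (hubbardInteraction L M β U + counterQuadratic L M β (klFlowFrameU L M β U μ m)) ≠ 0)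
    -- the flow history and the closed envelopes (verbatim from the door)
    {n : ℕ} (hP : ∀ m' ≤ n, FlowPieceJetsAt L M β U μ R m') (hTJ : ∀ m' ≤ n, TwoLegReadJetsF L M G Q β U μ m') (hmn : m ≤ n)
    (hR0 : 0 < R.Gfr 0) {W Ξ Θ : ℝ} (hW : W = curveExtC (8 * 576 * (342 : ℝ) ^ 4) G.S 1 + curveExtC (8 * 576 * (342 : ℝ) ^ 4) Q.S' 1 * |U|)
    (hΞ : Ξ = (2 ^ 10 * (1 + Real.pi ^ 8 * (W * U ^ 2) / 2 ^ 11) + ∑ j ∈ range 5, R.Gfr j))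
    (hΘ : Θ = (1 + ((∑ j ∈ range 5, R.Gfr j) + Real.pi ^ 8 * W / 2 ^ 11) * |U| / R.Gfr 0))
    (hdoor : R.Gfr 0 * |U| + ((∑ j ∈ range 5, R.Gfr j) + Real.pi ^ 8 * W / 2 ^ 11) * U ^ 2 ≤ 1 / 128) (hL : klEngL₄ P R β U ≤ L)
    {s : ℕ} (hs : 30 ≤ s)
    -- E1: β-free graded constant families (four-leg: PURE weight, `U²` law at orders ≥ 1)
    {cN cS cE : ℕ → ℝ} {cSs cEs : ℝ} (hcN : ∀ l, 0 ≤ cN l) (hcS : ∀ l, 0 ≤ cS l) (hcE : ∀ l, 0 ≤ cE l) (hcSs : 0 ≤ cSs) (hcEs : 0 ≤ cEs)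
    (hNp0 : ∀ t ∈ Set.Icc (0 : ℝ) 1, ∀ (σ : Fin 2) (A : HubbardFieldIdx L M) (x₀ : SpaceTimeIdx L M), imagTimeWeight β M ^ 3 *
      ∑ x ∈ (univ : Finset (Fin 4 → SpaceTimeIdx L M)).filter (fun x => x 0 = x₀),
        (((((x 1).2 - (x 0).2) 0).valMinAbs.natAbs : ℝ) + ((((x 1).2 - (x 0).2) 1).valMinAbs.natAbs : ℝ)) ^ 0 *
          ‖sectorisedKernel L M β (trivialMultiplier L M)
            (effAction ℂ (normalCovariance L M (uvSymbolCT L M β μ (klFlowFrameU L M β U μ m) (klScale klE0 m)) + ((t : ℂ)) • (normalCovariance L M (fun ks => uvSymbolCT L M β μ (klFlowFrameU L M β U μ (m + 1)) (klScale klE0 m) ks / (1 + uvSymbolCT L M β μ (klFlowFrameU L M β U μ (m + 1)) (klScale klE0 m) ks * (((fsub (klFlowFrameU L M β U μ (m + 1)) (klFlowFrameU L M β U μ m)).eval (latticeMomentum L ks.1.2) / (β * (L : ℝ) ^ 2) : ℝ) : ℂ))) - normalCovariance L M (uvSymbolCT L M β μ (klFlowFrameU L M β U μ m) (klScale klE0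 m)))) (hubbardInteraction L M β U + counterQuadratic L M β (klFlowFrameU L M β U μ m))) 4
            (![((0, σ), 0), ((0, σ), 1), ((0, A.1.2), 1 - A.2), ((0, A.1.2), A.2)] : Fin 4 → SectorLeg 1) x‖ ≤ cN 0 * U)
    (hNp : ∀ l, 1 ≤ l → l ≤ 4 → ∀ t ∈ Set.Icc (0 : ℝ) 1, ∀ (σ : Fin 2) (A : HubbardFieldIdx L M) (x₀ : SpaceTimeIdx L M), imagTimeWeight β M ^ 3 *
      ∑ x ∈ (univ : Finset (Fin 4 → SpaceTimeIdx L M)).filter (fun x => x 0 = x₀),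
        (((((x 1).2 - (x 0).2) 0).valMinAbs.natAbs : ℝ) + ((((x 1).2 - (x 0).2) 1).valMinAbs.natAbs : ℝ)) ^ l *
          ‖sectorisedKernel L M β (trivialMultiplier L M)
            (effAction ℂ (normalCovariance L M (uvSymbolCT L M β μ (klFlowFrameU L M β U μ m) (klScale klE0 m)) + ((t : ℂ)) • (normalCovariance L M (fun ks => uvSymbolCT L M β μ (klFlowFrameU L M β U μ (m + 1)) (klScale klE0 m) ks / (1 + uvSymbolCT L M β μ (klFlowFrameU L M β U μ (m + 1)) (klScale klE0 m) ks * (((fsub (klFlowFrameU L M β U μ (m + 1)) (klFlowFrameU L M β U μ m)).eval (latticeMomentum L ks.1.2) / (β * (L : ℝ) ^ 2) : ℝ) : ℂ))) - normalCovariance L M (uvSymbolCT L M β μ (klFlowFrameU L M β U μ m) (klScale klE0 m)))) (hubbardInteraction L M β U + counterQuadratic L M β (klFlowFrameU L M β U μ m))) 4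
            (![((0, σ), 0), ((0, σ), 1), ((0, A.1.2), 1 - A.2), ((0, A.1.2), A.2)] : Fin 4 → SectorLeg 1) x‖ ≤ cN l * U ^ 2 * ((4 : ℝ) ^ m) ^ l)
    (hSp : ∀ l ≤ 4, ∀ t ∈ Set.Icc (0 : ℝ) 1, ∀ (σ : Fin 2) (x₀ : SpaceTimeIdx L M),
      (imagTimeWeight β M * ∑ x ∈ (univ : Finset (Fin 2 → SpaceTimeIdx L M)).filter (fun x => x 0 = x₀),
        (1 + ((((x 1).2 - (x 0).2) 0).valMinAbs.natAbs : ℝ) + ((((x 1).2 - (x 0).2) 1).valMinAbs.natAbs : ℝ)) ^ l *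
          ‖sectorisedKernel L M β (trivialMultiplier L M)
            (effAction ℂ (normalCovariance L M (uvSymbolCT L M β μ (klFlowFrameU L M β U μ m) (klScale klE0 m)) + ((t : ℂ)) • (normalCovariance L M (fun ks => uvSymbolCT L M β μ (klFlowFrameU L M β U μ (m + 1)) (klScale klE0 m) ks / (1 + uvSymbolCT L M β μ (klFlowFrameU L M β U μ (m + 1)) (klScale klE0 m) ks * (((fsub (klFlowFrameU L M β U μ (m + 1)) (klFlowFrameU L M β U μ m)).eval (latticeMomentum L ks.1.2) / (β * (L : ℝ) ^ 2) : ℝ) : ℂ))) - normalCovariance L M (uvSymbolCT L M β μ (klFlowFrameU L M β U μ m) (klScale klE0 m)))) (hubbardInteraction L M β U + counterQuadratic L M β (klFlowFrameU L M β U μ m))) 2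
            (![((0, σ), 0), ((0, σ), 1)] : Fin 2 → SectorLeg 1) x‖ ≤ cS l * U * ((4 : ℝ) ^ m) ^ l))
    (hSps : ∀ t ∈ Set.Icc (0 : ℝ) 1, ∀ (σ : Fin 2) (x₀ : SpaceTimeIdx L M),
      (imagTimeWeight β M * ∑ x ∈ (univ : Finset (Fin 2 → SpaceTimeIdx L M)).filter (fun x => x 0 = x₀),
        (1 + ((((x 1).2 - (x 0).2) 0).valMinAbs.natAbs : ℝ) + ((((x 1).2 - (x 0).2) 1).valMinAbs.natAbs : ℝ)) ^ s *
          ‖sectorisedKernel L M β (trivialMultiplier L M)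
            (effAction ℂ (normalCovariance L M (uvSymbolCT L M β μ (klFlowFrameU L M β U μ m) (klScale klE0 m)) + ((t : ℂ)) • (normalCovariance L M (fun ks => uvSymbolCT L M β μ (klFlowFrameU L M β U μ (m + 1)) (klScale klE0 m) ks / (1 + uvSymbolCT L M β μ (klFlowFrameU L M β U μ (m + 1)) (klScale klE0 m) ks * (((fsub (klFlowFrameU L M β U μ (m + 1)) (klFlowFrameU L M β U μ m)).eval (latticeMomentum L ks.1.2) / (β * (L : ℝ) ^ 2) : ℝ) : ℂ))) - normalCovariance L M (uvSymbolCT L M β μ (klFlowFrameU L M β U μ m) (klScale klE0 m)))) (hubbardInteraction L M β U + counterQuadratic L M β (klFlowFrameU L M β U μ m))) 2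
            (![((0, σ), 0), ((0, σ), 1)] : Fin 2 → SectorLeg 1) x‖ ≤ cSs * U * ((4 : ℝ) ^ m) ^ s))
    (hSEp : ∀ l ≤ 4, ∀ (σ : Fin 2) (x₀ : SpaceTimeIdx L M),
      (imagTimeWeight β M * ∑ x ∈ (univ : Finset (Fin 2 → SpaceTimeIdx L M)).filter (fun x => x 0 = x₀),
        (1 + ((((x 1).2 - (x 0).2) 0).valMinAbs.natAbs : ℝ) + ((((x 1).2 - (x 0).2) 1).valMinAbs.natAbs : ℝ)) ^ l *
          ‖sectorisedKernel L M β (trivialMultiplier L M)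
            (effAction ℂ (normalCovariance L M (fun ks => uvSymbolCT L M β μ (klFlowFrameU L M β U μ (m + 1)) (klScale klE0 m) ks / (1 + uvSymbolCT L M β μ (klFlowFrameU L M β U μ (m + 1)) (klScale klE0 m) ks * (((fsub (klFlowFrameU L M β U μ (m + 1)) (klFlowFrameU L M β U μ m)).eval (latticeMomentum L ks.1.2) / (β * (L : ℝ) ^ 2) : ℝ) : ℂ)))) (hubbardInteraction L M β U + counterQuadratic L M β (klFlowFrameU L M β U μ m))) 2
            (![((0, σ), 0), ((0, σ), 1)] : Fin 2 → SectorLeg 1) x‖ ≤ cE l * U * ((4 : ℝ) ^ m) ^ l))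
    (hSEs : ∀ (σ : Fin 2) (x₀ : SpaceTimeIdx L M),
      (imagTimeWeight β M * ∑ x ∈ (univ : Finset (Fin 2 → SpaceTimeIdx L M)).filter (fun x => x 0 = x₀),
        (1 + ((((x 1).2 - (x 0).2) 0).valMinAbs.natAbs : ℝ) + ((((x 1).2 - (x 0).2) 1).valMinAbs.natAbs : ℝ)) ^ s *
          ‖sectorisedKernel L M β (trivialMultiplier L M)
            (effAction ℂ (normalCovariance L M (fun ks => uvSymbolCT L M β μ (klFlowFrameU L M β U μ (m + 1)) (klScale klE0 m) ks / (1 + uvSymbolCT L M β μ (klFlowFrameU L M β U μ (m + 1)) (klScale klE0 m) ks * (((fsub (klFlowFrameU L M β U μ (m + 1)) (klFlowFrameU L M β U μ m)).eval (latticeMomentum L ks.1.2) / (β * (L : ℝ) ^ 2) : ℝ) : ℂ)))) (hubbardInteraction L M β U + counterQuadratic L M β (klFlowFrameU L M β U μ m))) 2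
            (![((0, σ), 0), ((0, σ), 1)] : Fin 2 → SectorLeg 1) x‖ ≤ cEs * U * ((4 : ℝ) ^ m) ^ s))
    -- the (B) budget word as a primed table
    {X : ℕ → ℝ} (hX0 : ∀ l, 0 ≤ X l)
    (hXv : 2 ^ 32 / 4 ^ 0 * R.Gfr 0 * cN 0 + (klEngRsq R ^ 4 * (cS 0 ^ 2 + cE 0 + 1) + (cSs ^ 2 + cEs + 1)) / 2 ^ 200 ≤ X 0)
    (hX : ∀ l, 1 ≤ l → l ≤ 4 → 2 ^ 32 / 4 ^ l * R.Gfr 0 * cN l + (klEngRsq R ^ 4 * (cS l ^ 2 + cE l + 1) + (cSs ^ 2 + cEs + 1)) / 2 ^ 200 ≤ X l)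
    -- the (P)-step's other inputs (k3c3-p1 `twoLegReadPriv_flow_succ` at `n := m`)
    (hLdeg : 4 * klFlowDeg (m + 1) ≤ L)
    {cA cA' cc cc' : ℕ → ℝ} {τA a x₀ : ℝ} (hcc : ∀ k, 0 ≤ cc k) (hcc' : ∀ k, 0 ≤ cc' k)
    -- (A): slice-increment jets and structured value at the new frame
    (hA : TwoLegCurveJetBound L M cA cA' β U μ (klFlowFrameU L M β U μ (m + 1)) (m + 1))
    (hAval : ∀ θ : ℝ, |klTwoLegCurveProfile L M β U μ (klFlowFrameU L M β U μ (m + 1)) (m + 1) θ - τA| ≤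
      a * U ^ 2 * (4 : ℝ) ^ (-2 * ((m + 1 : ℕ) : ℤ)))
    -- (C2): the #17 export at `(K_m, m)`, five n-free rows, and a primed table above `transport_jets_flow_fit`'s
    {z : ℕ → ℝ} (hZsp : TwoLegDualSpaceMomentsUpToAt L M (klZspLaw z U m) β U μ m 5)
    {mT : ℕ → ℝ} (hmT : ∀ j, 0 ≤ mT j)
    (hmT1 : 4 / 3 * R.Gfr 1 + 2 * z 1 ≤ mT 1) (hmT2 : R.Gfr 2 + 2 * z 2 ≤ mT 2) (hmT3 : R.Gfr 3 / 3 + 2 * z 3 ≤ mT 3)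
    (hmT4 : R.Gfr 4 / 15 + 2 * z 4 ≤ mT 4) (hmT5 : 2 ^ 5 * (Real.pi ^ 8 / 4 * 2 ^ 4 * (2 : ℝ) ^ 32) * (curveExtC (klChi2CauchyTab2 4) G.S 1 + curveExtC (klChi2CauchyTab2 4) Q.S' 1 * |U|) / 63 + 2 * z 5 ≤ mT 5)
    {eT' : ℕ → ℝ} (heT : ∀ k ≤ 4,
        (fun k : ℕ =>
          if k = 0 then 16 * ((12.2 * R.Gfr 0 * mT 1))
          else if k = 1 then 4 * ((1420 * 2 * (R.Gfr 1 + R.Gfr 2 + R.Gfr 3 + R.Gfr 4) * (1 + 2 * (R.Gfr 3 + R.Gfr 4)) * mT 1) + (36400 * R.Gfr 0 * mT 1) + (2820 * R.Gfr 0 * mT 2))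
          else if k = 2 then ((12900000 * 2 ^ 2 * (R.Gfr 1 + R.Gfr 2 + R.Gfr 3 + R.Gfr 4) * (1 + 2 * (R.Gfr 3 + R.Gfr 4)) ^ 2 * mT 1) + (657000 * 2 * (R.Gfr 1 + R.Gfr 2 + R.Gfr 3 + R.Gfr 4) * (1 + 2 * (R.Gfr 3 + R.Gfr 4)) * mT 2) + (338000000 * 2 * R.Gfr 0 * (1 + 2 * (R.Gfr 3 + R.Gfr 4)) * mT 1) + (25400000 * R.Gfr 0 * mT 2) + (652000 * R.Gfr 0 * mT 3))
          else if k = 3 then ((199000000000 * 2 ^ 3 * (R.Gfr 1 + R.Gfr 2 + R.Gfr 3 + R.Gfr 4) * (1 + 2 * (R.Gfr 3 + R.Gfr 4)) ^ 3 * mT 1) + (12000000000 * 2 ^ 2 * (R.Gfr 1 + R.Gfr 2 + R.Gfr 3 + R.Gfr 4) * (1 + 2 * (R.Gfr 3 + R.Gfr 4)) ^ 2 * mT 2) + (228000000 * 2 * (R.Gfr 1 + R.Gfr 2 + R.Gfr 3 + R.Gfr 4) * (1 + 2 * (R.Gfr 3 + R.Gfr 4)) * mT 3) + (5230000000000 *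 2 ^ 2 * R.Gfr 0 * (1 + 2 * (R.Gfr 3 + R.Gfr 4)) ^ 2 * mT 1) + (392000000000 * 2 * R.Gfr 0 * (1 + 2 * (R.Gfr 3 + R.Gfr 4)) * mT 2) + (11800000000 * R.Gfr 0 * mT 3) + (151000000 * R.Gfr 0 * mT 4)) / 4
          else if k = 4 then ((4300000000000000 * 2 ^ 4 * (R.Gfr 1 + R.Gfr 2 + R.Gfr 3 + R.Gfr 4) * (1 + 2 * (R.Gfr 3 + R.Gfr 4)) ^ 4 * mT 1) + (276000000000000 * 2 ^ 3 * (R.Gfr 1 + R.Gfr 2 + R.Gfr 3 + R.Gfr 4) * (1 + 2 * (R.Gfr 3 + R.Gfr 4)) ^ 3 * mT 2) + (6890000000000 * 2 ^ 2 * (R.Gfr 1 + R.Gfr 2 + R.Gfr 3 + R.Gfr 4) * (1 + 2 * (R.Gfr 3 + R.Gfr 4)) ^ 2 * mT 3) + (70100000000 * 2 * (R.Gfr 1 + R.Gfr 2 + R.Gfr 3 + R.Gfr 4) * (1 + 2 * (R.Gfr 3 + R.Gfr 4)) * mT 4) + (114000000000000000 * 2 ^ 2 * R.Gfr 0 * (1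 + 2 * (R.Gfr 3 + R.Gfr 4)) ^ 2 * mT 1) + (8490000000000000 * 2 ^ 2 * R.Gfr 0 * (1 + 2 * (R.Gfr 3 + R.Gfr 4)) ^ 2 * mT 2) + (272000000000000 * 2 * R.Gfr 0 * (1 + 2 * (R.Gfr 3 + R.Gfr 4)) * mT 3) + (4530000000000 * R.Gfr 0 * mT 4) + (34800000000 * R.Gfr 0 * mT 5) + (69200000000 * (16 / 15) * R.Gfr 4 * mT 1)) / 16
          else 0) k ≤ eT' k)
    -- (C1): the window certificate of the analytic branch and the induction hypothesis (jets half) at the private tables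
    (hcertA : KlwjCertA) (hIH : TwoLegReadJetBound L M cc cc' β U μ (klFlowFrameU L M β U μ m) m)
    -- the three private fits: (B), (C2) un-primed columns EMPTY, (C1) = the analytic matrix `klC1AnFit`
    (hfit : ∀ k, cA k + klC1AnFit cc k ≤ cc k)
    (hfit' : ∀ k, cA' k + ((if k = 0 then X 0 else readJetC X k + readJetC' R X k) + eT' k + klC1AnFit' cc cc' k) ≤ cc' k)
    (hfitO : a + (X 0 + eT' 0 + klC1AnFit' cc cc' 0) ≤ x₀ / 2) :
    TwoLegReadJetBound L M cc cc' β U μ (klFlowFrameU L M β U μ (m + 1)) (m + 1) ∧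
      TwoLegReadOscAt L M x₀ β U μ (klFlowFrameU L M β U μ (m + 1)) (m + 1) := by
  have hR : ∀ j, 0 ≤ R.Gfr j := hRW.2.2
  have hcle : c ≤ klCurveC3 R := hc6.trans ((klEngC₃6_le_klEngC₃3 P R).trans (klEngC₃3_le_klCurveC3 P hR))
  have hUle : U ≤ klCurveU0 R := hU9.trans ((klEngU₀9_le_klEngU₀3 P R c).trans (klEngU₀3_le_klCurveU0 P hR c))
  have hU1 : U ≤ 1 := hUle.trans (klCurveU0_le_one R)
  have hreg : IsKLRegime U c (-((m + 1 : ℕ) : ℤ)) := isKLRegime_of_le_nScales_succ hc.le hβmin hβc (by omega)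
  obtain ⟨hJdiff, hJ⟩ := readResidueC1_hJ_analytic_klEng (L := L) (M := M) hcertA hRW hc hc6 hμ hU hU9 hβmin hβc hm5 hreg
    (FrameOK.mono hR (hNn.trans (by omega)) hOK₂) (fun m' hm' => hP m' (by omega)) hcc hcc' hIH
  exact twoLegReadPriv_flow_succ_of_pos_pure_c2_sharp hR hc hcle hU hU1 hUle hβmin hβc hμ m hm1 hGS hQS hOK₁ hN₁ hOK₂ hNn hZ₂ hZ hP hTJ hmn hR0 hW hΞ hΘ
    hdoor hL hs hcN hcS hcE hcSs hcEs hNp0 hNp hSp hSps hSEp hSEs hX0 hXv hX hLdeg hA hAval hZsp hmT hmT1 hmT2 hmT3 hmT4 hmT5 heT hJdiff hJ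
    (klC1AnFit_zero cc) hfit hfit' hfitO

/-! ## §2 Shallow scales: the (C1) table branch -/

/-- **«(P)-STEP-TABLE» — the private (P)-step at a SHALLOW general scale `m + 1 ≤ 21`, `m + 1 ≤ n_β`, with (B), (C2) AND (C1) discharged by name**
((C1) = k3c3-p1's table branch `readResidueC1_hJ_of_twoLegReadJetBound_klEng` at a cutoff-defect certificate `CutoffDefectCertFrame (klFlowDeg m) A T`,
read below ANY tables `eJ, eJ′` dominating its explicit linear forms at `k ≤ 4`, `eJ 0 = 0`).  See the module docstring.
[cite: BenfattoGiulianiMastropietro2006, §2.4 Lemma 2.1 (2.36)–(2.42)] -/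
theorem twoLegReadPriv_flow_succ_table {P : SplitConsts} {R : RenConsts} (hRW : R.WF) {c : ℝ} (hc : 0 < c) (hc6 : c ≤ klEngC₃6 P R)
    {U : ℝ} (hU : 0 < U) (hU9 : U ≤ klEngU₀9 P R c) {β : ℝ} (hβmin : klBetaMin ≤ β) (hβc : β ≤ Real.exp (c / U ^ 2))
    {μ : ℝ} (hμ : μ ∈ klWindowC) (m : ℕ) (hm21 : m + 1 ≤ 21) (hm1 : m + 1 ≤ nScales β)
    {G : GeoConsts} {Q : EngConsts} (hGS : ∀ k, 0 ≤ G.S k) (hQS : ∀ k, 0 ≤ Q.S' k)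
    {Nf₁ N : ℕ} (hOK₁ : FrameOK R U Nf₁ μ (klFlowFrameU L M β U μ m)) (hN₁ : Nf₁ ≤ m) (hOK₂ : FrameOK R U N μ (klFlowFrameU L M β U μ (m + 1))) (hNn : N ≤ m)
    (hZ₂ : IsUnit (effPartitionFn ℂ (normalCovariance L M (uvSymbolCT L M β μ (klFlowFrameU L M β U μ (m + 1)) (klScale klE0 m))) (hubbardInteraction L M β U + counterQuadratic L M β (klFlowFrameU L M β U μ (m + 1)))))
    (hZ : ∀ t ∈ Set.Icc (0 : ℝ) 1, effPartitionFn ℂ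
      (normalCovariance L M (uvSymbolCT L M β μ (klFlowFrameU L M β U μ m) (klScale klE0 m)) + ((t : ℂ)) • (normalCovariance L M (fun ks => uvSymbolCT L M β μ (klFlowFrameU L M β U μ (m + 1)) (klScale klE0 m) ks / (1 + uvSymbolCT L M β μ (klFlowFrameU L M β U μ (m + 1)) (klScale klE0 m) ks * (((fsub (klFlowFrameU L M β U μ (m + 1)) (klFlowFrameU L M β U μ m)).eval (latticeMomentum L ks.1.2) / (β * (L : ℝ) ^ 2) : ℝ) : ℂ))) - normalCovariance L M (uvSymbolCT L M β μ (klFlowFrameU L M β U μ m) (klScale klE0 m)))) (hubbardInteraction L M β U + counterQuadratic L M β (klFlowFrameU L M β U μ m)) ≠ 0)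
    -- the flow history and the closed envelopes (verbatim from the door)
    {n : ℕ} (hP : ∀ m' ≤ n, FlowPieceJetsAt L M β U μ R m') (hTJ : ∀ m' ≤ n, TwoLegReadJetsF L M G Q β U μ m') (hmn : m ≤ n)
    (hR0 : 0 < R.Gfr 0) {W Ξ Θ : ℝ} (hW : W = curveExtC (8 * 576 * (342 : ℝ) ^ 4) G.S 1 + curveExtC (8 * 576 * (342 : ℝ) ^ 4) Q.S' 1 * |U|)
    (hΞ : Ξ = (2 ^ 10 * (1 + Real.pi ^ 8 * (W * U ^ 2) / 2 ^ 11) + ∑ j ∈ range 5, R.Gfr j))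
    (hΘ : Θ = (1 + ((∑ j ∈ range 5, R.Gfr j) + Real.pi ^ 8 * W / 2 ^ 11) * |U| / R.Gfr 0))
    (hdoor : R.Gfr 0 * |U| + ((∑ j ∈ range 5, R.Gfr j) + Real.pi ^ 8 * W / 2 ^ 11) * U ^ 2 ≤ 1 / 128) (hL : klEngL₄ P R β U ≤ L)
    {s : ℕ} (hs : 30 ≤ s)
    -- E1: β-free graded constant families (four-leg: PURE weight, `U²` law at orders ≥ 1)
    {cN cS cE : ℕ → ℝ} {cSs cEs : ℝ} (hcN : ∀ l, 0 ≤ cN l) (hcS : ∀ l, 0 ≤ cS l) (hcE : ∀ l, 0 ≤ cE l) (hcSs : 0 ≤ cSs) (hcEs : 0 ≤ cEs)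
    (hNp0 : ∀ t ∈ Set.Icc (0 : ℝ) 1, ∀ (σ : Fin 2) (A : HubbardFieldIdx L M) (x₀ : SpaceTimeIdx L M), imagTimeWeight β M ^ 3 *
      ∑ x ∈ (univ : Finset (Fin 4 → SpaceTimeIdx L M)).filter (fun x => x 0 = x₀),
        (((((x 1).2 - (x 0).2) 0).valMinAbs.natAbs : ℝ) + ((((x 1).2 - (x 0).2) 1).valMinAbs.natAbs : ℝ)) ^ 0 *
          ‖sectorisedKernel L M β (trivialMultiplier L M)
            (effAction ℂ (normalCovariance L M (uvSymbolCT L M β μ (klFlowFrameU L M β U μ m) (klScale klE0 m)) + ((t : ℂ)) • (normalCovariance L M (fun ks => uvSymbolCT L M β μ (klFlowFrameU L M β U μ (m + 1)) (klScale klE0 m) ks / (1 + uvSymbolCT L M β μ (klFlowFrameU L M β U μ (m + 1)) (klScale klE0 m) ks * (((fsub (klFlowFrameU L M β U μ (m + 1)) (klFlowFrameU L M β U μ m)).eval (latticeMomentum L ks.1.2) / (β * (L : ℝ) ^ 2) : ℝ) : ℂ))) - normalCovariance L M (uvSymbolCT L M β μ (klFlowFrameU L M β U μ m) (klScale klE0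 m)))) (hubbardInteraction L M β U + counterQuadratic L M β (klFlowFrameU L M β U μ m))) 4
            (![((0, σ), 0), ((0, σ), 1), ((0, A.1.2), 1 - A.2), ((0, A.1.2), A.2)] : Fin 4 → SectorLeg 1) x‖ ≤ cN 0 * U)
    (hNp : ∀ l, 1 ≤ l → l ≤ 4 → ∀ t ∈ Set.Icc (0 : ℝ) 1, ∀ (σ : Fin 2) (A : HubbardFieldIdx L M) (x₀ : SpaceTimeIdx L M), imagTimeWeight β M ^ 3 *
      ∑ x ∈ (univ : Finset (Fin 4 → SpaceTimeIdx L M)).filter (fun x => x 0 = x₀),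
        (((((x 1).2 - (x 0).2) 0).valMinAbs.natAbs : ℝ) + ((((x 1).2 - (x 0).2) 1).valMinAbs.natAbs : ℝ)) ^ l *
          ‖sectorisedKernel L M β (trivialMultiplier L M)
            (effAction ℂ (normalCovariance L M (uvSymbolCT L M β μ (klFlowFrameU L M β U μ m) (klScale klE0 m)) + ((t : ℂ)) • (normalCovariance L M (fun ks => uvSymbolCT L M β μ (klFlowFrameU L M β U μ (m + 1)) (klScale klE0 m) ks / (1 + uvSymbolCT L M β μ (klFlowFrameU L M β U μ (m + 1)) (klScale klE0 m) ks * (((fsub (klFlowFrameU L M β U μ (m + 1)) (klFlowFrameU L M β U μ m)).eval (latticeMomentum L ks.1.2) / (β * (L : ℝ) ^ 2) : ℝ) : ℂ))) - normalCovariance L M (uvSymbolCT L M β μ (klFlowFrameU L M β U μ m) (klScale klE0 m)))) (hubbardInteraction L M β U + counterQuadratic L M β (klFlowFrameU L M β U μ m))) 4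
            (![((0, σ), 0), ((0, σ), 1), ((0, A.1.2), 1 - A.2), ((0, A.1.2), A.2)] : Fin 4 → SectorLeg 1) x‖ ≤ cN l * U ^ 2 * ((4 : ℝ) ^ m) ^ l)
    (hSp : ∀ l ≤ 4, ∀ t ∈ Set.Icc (0 : ℝ) 1, ∀ (σ : Fin 2) (x₀ : SpaceTimeIdx L M),
      (imagTimeWeight β M * ∑ x ∈ (univ : Finset (Fin 2 → SpaceTimeIdx L M)).filter (fun x => x 0 = x₀),
        (1 + ((((x 1).2 - (x 0).2) 0).valMinAbs.natAbs : ℝ) + ((((x 1).2 - (x 0).2) 1).valMinAbs.natAbs : ℝ)) ^ l *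
          ‖sectorisedKernel L M β (trivialMultiplier L M)
            (effAction ℂ (normalCovariance L M (uvSymbolCT L M β μ (klFlowFrameU L M β U μ m) (klScale klE0 m)) + ((t : ℂ)) • (normalCovariance L M (fun ks => uvSymbolCT L M β μ (klFlowFrameU L M β U μ (m + 1)) (klScale klE0 m) ks / (1 + uvSymbolCT L M β μ (klFlowFrameU L M β U μ (m + 1)) (klScale klE0 m) ks * (((fsub (klFlowFrameU L M β U μ (m + 1)) (klFlowFrameU L M β U μ m)).eval (latticeMomentum L ks.1.2) / (β * (L : ℝ) ^ 2) : ℝ) : ℂ))) - normalCovariance L M (uvSymbolCT L M β μ (klFlowFrameU L M β U μ m) (klScale klE0 m)))) (hubbardInteraction L M β U + counterQuadratic L M β (klFlowFrameU L M β U μ m))) 2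
            (![((0, σ), 0), ((0, σ), 1)] : Fin 2 → SectorLeg 1) x‖ ≤ cS l * U * ((4 : ℝ) ^ m) ^ l))
    (hSps : ∀ t ∈ Set.Icc (0 : ℝ) 1, ∀ (σ : Fin 2) (x₀ : SpaceTimeIdx L M),
      (imagTimeWeight β M * ∑ x ∈ (univ : Finset (Fin 2 → SpaceTimeIdx L M)).filter (fun x => x 0 = x₀),
        (1 + ((((x 1).2 - (x 0).2) 0).valMinAbs.natAbs : ℝ) + ((((x 1).2 - (x 0).2) 1).valMinAbs.natAbs : ℝ)) ^ s *
          ‖sectorisedKernel L M β (trivialMultiplier L M)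
            (effAction ℂ (normalCovariance L M (uvSymbolCT L M β μ (klFlowFrameU L M β U μ m) (klScale klE0 m)) + ((t : ℂ)) • (normalCovariance L M (fun ks => uvSymbolCT L M β μ (klFlowFrameU L M β U μ (m + 1)) (klScale klE0 m) ks / (1 + uvSymbolCT L M β μ (klFlowFrameU L M β U μ (m + 1)) (klScale klE0 m) ks * (((fsub (klFlowFrameU L M β U μ (m + 1)) (klFlowFrameU L M β U μ m)).eval (latticeMomentum L ks.1.2) / (β * (L : ℝ) ^ 2) : ℝ) : ℂ))) - normalCovariance L M (uvSymbolCT L M β μ (klFlowFrameU L M β U μ m) (klScale klE0 m)))) (hubbardInteraction L M β U + counterQuadratic L M β (klFlowFrameU L M β U μ m))) 2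
            (![((0, σ), 0), ((0, σ), 1)] : Fin 2 → SectorLeg 1) x‖ ≤ cSs * U * ((4 : ℝ) ^ m) ^ s))
    (hSEp : ∀ l ≤ 4, ∀ (σ : Fin 2) (x₀ : SpaceTimeIdx L M),
      (imagTimeWeight β M * ∑ x ∈ (univ : Finset (Fin 2 → SpaceTimeIdx L M)).filter (fun x => x 0 = x₀),
        (1 + ((((x 1).2 - (x 0).2) 0).valMinAbs.natAbs : ℝ) + ((((x 1).2 - (x 0).2) 1).valMinAbs.natAbs : ℝ)) ^ l *
          ‖sectorisedKernel L M β (trivialMultiplier L M)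
            (effAction ℂ (normalCovariance L M (fun ks => uvSymbolCT L M β μ (klFlowFrameU L M β U μ (m + 1)) (klScale klE0 m) ks / (1 + uvSymbolCT L M β μ (klFlowFrameU L M β U μ (m + 1)) (klScale klE0 m) ks * (((fsub (klFlowFrameU L M β U μ (m + 1)) (klFlowFrameU L M β U μ m)).eval (latticeMomentum L ks.1.2) / (β * (L : ℝ) ^ 2) : ℝ) : ℂ)))) (hubbardInteraction L M β U + counterQuadratic L M β (klFlowFrameU L M β U μ m))) 2
            (![((0, σ), 0), ((0, σ), 1)] : Fin 2 → SectorLeg 1) x‖ ≤ cE l * U * ((4 : ℝ) ^ m) ^ l))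
    (hSEs : ∀ (σ : Fin 2) (x₀ : SpaceTimeIdx L M),
      (imagTimeWeight β M * ∑ x ∈ (univ : Finset (Fin 2 → SpaceTimeIdx L M)).filter (fun x => x 0 = x₀),
        (1 + ((((x 1).2 - (x 0).2) 0).valMinAbs.natAbs : ℝ) + ((((x 1).2 - (x 0).2) 1).valMinAbs.natAbs : ℝ)) ^ s *
          ‖sectorisedKernel L M β (trivialMultiplier L M)
            (effAction ℂ (normalCovariance L M (fun ks => uvSymbolCT L M β μ (klFlowFrameU L M β U μ (m + 1)) (klScale klE0 m) ks / (1 + uvSymbolCT L M β μ (klFlowFrameU L M β U μ (m + 1)) (klScale klE0 m) ks * (((fsub (klFlowFrameU L M β U μ (m + 1)) (klFlowFrameU L M β U μ m)).eval (latticeMomentum L ks.1.2) / (β * (L : ℝ) ^ 2) : ℝ) : ℂ)))) (hubbardInteraction L M β U + counterQuadratic L M β (klFlowFrameU L M β U μ m))) 2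
            (![((0, σ), 0), ((0, σ), 1)] : Fin 2 → SectorLeg 1) x‖ ≤ cEs * U * ((4 : ℝ) ^ m) ^ s))
    -- the (B) budget word as a primed table
    {X : ℕ → ℝ} (hX0 : ∀ l, 0 ≤ X l)
    (hXv : 2 ^ 32 / 4 ^ 0 * R.Gfr 0 * cN 0 + (klEngRsq R ^ 4 * (cS 0 ^ 2 + cE 0 + 1) + (cSs ^ 2 + cEs + 1)) / 2 ^ 200 ≤ X 0)
    (hX : ∀ l, 1 ≤ l → l ≤ 4 → 2 ^ 32 / 4 ^ l * R.Gfr 0 * cN l + (klEngRsq R ^ 4 * (cS l ^ 2 + cE l + 1) + (cSs ^ 2 + cEs + 1)) / 2 ^ 200 ≤ X l)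
    -- the (P)-step's other inputs (k3c3-p1 `twoLegReadPriv_flow_succ` at `n := m`)
    (hLdeg : 4 * klFlowDeg (m + 1) ≤ L)
    {cA cA' cc cc' : ℕ → ℝ} {τA a x₀ : ℝ} (hcc : ∀ k, 0 ≤ cc k) (hcc' : ∀ k, 0 ≤ cc' k)
    -- (A): slice-increment jets and structured value at the new frame
    (hA : TwoLegCurveJetBound L M cA cA' β U μ (klFlowFrameU L M β U μ (m + 1)) (m + 1))
    (hAval : ∀ θ : ℝ, |klTwoLegCurveProfile L M β U μ (klFlowFrameU L M β U μ (m + 1)) (m + 1) θ - τA| ≤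
      a * U ^ 2 * (4 : ℝ) ^ (-2 * ((m + 1 : ℕ) : ℤ)))
    -- (C2): the #17 export at `(K_m, m)`, five n-free rows, and a primed table above `transport_jets_flow_fit`'s
    {z : ℕ → ℝ} (hZsp : TwoLegDualSpaceMomentsUpToAt L M (klZspLaw z U m) β U μ m 5)
    {mT : ℕ → ℝ} (hmT : ∀ j, 0 ≤ mT j)
    (hmT1 : 4 / 3 * R.Gfr 1 + 2 * z 1 ≤ mT 1) (hmT2 : R.Gfr 2 + 2 * z 2 ≤ mT 2) (hmT3 : R.Gfr 3 / 3 + 2 * z 3 ≤ mT 3)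
    (hmT4 : R.Gfr 4 / 15 + 2 * z 4 ≤ mT 4) (hmT5 : 2 ^ 5 * (Real.pi ^ 8 / 4 * 2 ^ 4 * (2 : ℝ) ^ 32) * (curveExtC (klChi2CauchyTab2 4) G.S 1 + curveExtC (klChi2CauchyTab2 4) Q.S' 1 * |U|) / 63 + 2 * z 5 ≤ mT 5)
    {eT' : ℕ → ℝ} (heT : ∀ k ≤ 4,
        (fun k : ℕ =>
          if k = 0 then 16 * ((12.2 * R.Gfr 0 * mT 1))
          else if k = 1 then 4 * ((1420 * 2 * (R.Gfr 1 + R.Gfr 2 + R.Gfr 3 + R.Gfr 4) * (1 + 2 * (R.Gfr 3 + R.Gfr 4)) * mT 1) + (36400 * R.Gfr 0 * mT 1) + (2820 * R.Gfr 0 * mT 2))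
          else if k = 2 then ((12900000 * 2 ^ 2 * (R.Gfr 1 + R.Gfr 2 + R.Gfr 3 + R.Gfr 4) * (1 + 2 * (R.Gfr 3 + R.Gfr 4)) ^ 2 * mT 1) + (657000 * 2 * (R.Gfr 1 + R.Gfr 2 + R.Gfr 3 + R.Gfr 4) * (1 + 2 * (R.Gfr 3 + R.Gfr 4)) * mT 2) + (338000000 * 2 * R.Gfr 0 * (1 + 2 * (R.Gfr 3 + R.Gfr 4)) * mT 1) + (25400000 * R.Gfr 0 * mT 2) + (652000 * R.Gfr 0 * mT 3))
          else if k = 3 then ((199000000000 * 2 ^ 3 * (R.Gfr 1 + R.Gfr 2 + R.Gfr 3 + R.Gfr 4) * (1 + 2 * (R.Gfr 3 + R.Gfr 4)) ^ 3 * mT 1) + (12000000000 * 2 ^ 2 * (R.Gfr 1 + R.Gfr 2 + R.Gfr 3 + R.Gfr 4) * (1 + 2 * (R.Gfr 3 + R.Gfr 4)) ^ 2 * mT 2) + (228000000 * 2 * (R.Gfr 1 + R.Gfr 2 + R.Gfr 3 + R.Gfr 4) * (1 + 2 * (R.Gfr 3 + R.Gfr 4)) * mT 3) + (5230000000000 *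 2 ^ 2 * R.Gfr 0 * (1 + 2 * (R.Gfr 3 + R.Gfr 4)) ^ 2 * mT 1) + (392000000000 * 2 * R.Gfr 0 * (1 + 2 * (R.Gfr 3 + R.Gfr 4)) * mT 2) + (11800000000 * R.Gfr 0 * mT 3) + (151000000 * R.Gfr 0 * mT 4)) / 4
          else if k = 4 then ((4300000000000000 * 2 ^ 4 * (R.Gfr 1 + R.Gfr 2 + R.Gfr 3 + R.Gfr 4) * (1 + 2 * (R.Gfr 3 + R.Gfr 4)) ^ 4 * mT 1) + (276000000000000 * 2 ^ 3 * (R.Gfr 1 + R.Gfr 2 + R.Gfr 3 + R.Gfr 4) * (1 + 2 * (R.Gfr 3 + R.Gfr 4)) ^ 3 * mT 2) + (6890000000000 * 2 ^ 2 * (R.Gfr 1 + R.Gfr 2 + R.Gfr 3 + R.Gfr 4) * (1 + 2 * (R.Gfr 3 + R.Gfr 4)) ^ 2 * mT 3) + (70100000000 * 2 * (R.Gfr 1 + R.Gfr 2 + R.Gfr 3 + R.Gfr 4) * (1 + 2 * (R.Gfr 3 + R.Gfr 4)) * mT 4) + (114000000000000000 * 2 ^ 2 * R.Gfr 0 * (1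 + 2 * (R.Gfr 3 + R.Gfr 4)) ^ 2 * mT 1) + (8490000000000000 * 2 ^ 2 * R.Gfr 0 * (1 + 2 * (R.Gfr 3 + R.Gfr 4)) ^ 2 * mT 2) + (272000000000000 * 2 * R.Gfr 0 * (1 + 2 * (R.Gfr 3 + R.Gfr 4)) * mT 3) + (4530000000000 * R.Gfr 0 * mT 4) + (34800000000 * R.Gfr 0 * mT 5) + (69200000000 * (16 / 15) * R.Gfr 4 * mT 1)) / 16
          else 0) k ≤ eT' k)
    -- (C1): the cutoff-defect certificate of the table branch at degree `klFlowDeg m`, the induction hypothesis (jets half), tables above the door's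
    {d : ℕ} (hd : klFlowDeg m = d) {A : ℕ → ℝ} {T : CutoffDefectTable} (hcert : CutoffDefectCertFrame d A T) (hTd : 0 ≤ T.Td) (hN0 : 0 ≤ T.N0)
    (hA12 : ∀ j ≤ 4, (1 : ℝ) / 10 ^ 12 ≤ A j) (hIH : TwoLegReadJetBound L M cc cc' β U μ (klFlowFrameU L M β U μ m) m)
    {eJ eJ' : ℕ → ℝ} (heJ0 : eJ 0 = 0)
    (heJ : ∀ k ≤ 4,
        (fun k => if k = 0 then 0 else
          (if k ≤ 3 then T.bound (fun l : ℕ => if l = 0 then π / 2 * cc 1 * (4 : ℝ) ^ ((((1 : ℕ) : ℤ) - 2) * m) else cc l * (4 : ℝ) ^ (((l : ℤ) - 2) * m)) k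
            else T.boundNR (fun l : ℕ => if l = 0 then π / 2 * cc 1 * (4 : ℝ) ^ ((((1 : ℕ) : ℤ) - 2) * m) else cc l * (4 : ℝ) ^ (((l : ℤ) - 2) * m)) k) *
            ((4 : ℝ) ^ (((k : ℤ) - 2) * ((m + 1 : ℕ) : ℤ)))⁻¹) k ≤ eJ k)
    (heJ' : ∀ k ≤ 4,
        (fun k => if k = 0 then (cc 1 + cc' 1) * (T.Td + π / 2 * T.N0) * (4 : ℝ) ^ ((((1 : ℕ) : ℤ) - 2) * m) *
            ((4 : ℝ) ^ ((((0 : ℕ) : ℤ) - 2) * ((m + 1 : ℕ) : ℤ)))⁻¹ else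
          (if k ≤ 3 then T.bound (fun l : ℕ => if l = 0 then π / 2 * cc' 1 * (4 : ℝ) ^ ((((1 : ℕ) : ℤ) - 2) * m) else cc' l * (4 : ℝ) ^ (((l : ℤ) - 2) * m)) k
            else T.boundNR (fun l : ℕ => if l = 0 then π / 2 * cc' 1 * (4 : ℝ) ^ ((((1 : ℕ) : ℤ) - 2) * m) else cc' l * (4 : ℝ) ^ (((l : ℤ) - 2) * m)) k) *
            ((4 : ℝ) ^ (((k : ℤ) - 2) * ((m + 1 : ℕ) : ℤ)))⁻¹) k ≤ eJ' k)
    -- the three private fits, (B) and (C2) un-primed columns EMPTY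
    (hfit : ∀ k, cA k + eJ k ≤ cc k)
    (hfit' : ∀ k, cA' k + ((if k = 0 then X 0 else readJetC X k + readJetC' R X k) + eT' k + eJ' k) ≤ cc' k)
    (hfitO : a + (X 0 + eT' 0 + eJ' 0) ≤ x₀ / 2) :
    TwoLegReadJetBound L M cc cc' β U μ (klFlowFrameU L M β U μ (m + 1)) (m + 1) ∧
      TwoLegReadOscAt L M x₀ β U μ (klFlowFrameU L M β U μ (m + 1)) (m + 1) := by
  have hR : ∀ j, 0 ≤ R.Gfr j := hRW.2.2
  have hcle : c ≤ klCurveC3 R := hc6.trans ((klEngC₃6_le_klEngC₃3 P R).trans (klEngC₃3_le_klCurveC3 P hR))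
  have hUle : U ≤ klCurveU0 R := hU9.trans ((klEngU₀9_le_klEngU₀3 P R c).trans (klEngU₀3_le_klCurveU0 P hR c))
  have hU1 : U ≤ 1 := hUle.trans (klCurveU0_le_one R)
  obtain ⟨hJdiff, hJ0⟩ := readResidueC1_hJ_of_twoLegReadJetBound_klEng (L := L) (M := M) hRW hc hc6 hμ hU hU9 hβmin hβc hm21
    (FrameOK.mono hR (hNn.trans (by omega)) hOK₂) (fun m' hm' => hP m' (by omega)) hd hcert hTd hN0 hA12 hcc hcc' hIH
  have hJ : ∀ k ≤ 4, ∀ θ : ℝ, |iteratedDeriv k (fun θ : ℝ => klLocalPart L M β U μ (klFlowFrameU L M β U μ m) m θ -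
      (klFlowPiece L M β U μ m).eval (klFermiPoint μ (klFlowFrameU L M β U μ (m + 1)) θ)) θ| ≤ curveJetBar eJ eJ' U k (m + 1) :=
    fun k hk θ => (hJ0 k hk θ).trans (curveJetBar_mono_at (heJ k hk) (heJ' k hk))
  exact twoLegReadPriv_flow_succ_of_pos_pure_c2_sharp hR hc hcle hU hU1 hUle hβmin hβc hμ m hm1 hGS hQS hOK₁ hN₁ hOK₂ hNn hZ₂ hZ hP hTJ hmn hR0 hW hΞ hΘ
    hdoor hL hs hcN hcS hcE hcSs hcEs hNp0 hNp hSp hSps hSEp hSEs hX0 hXv hX hLdeg hA hAval hZsp hmT hmT1 hmT2 hmT3 hmT4 hmT5 heT hJdiff hJ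
    heJ0 hfit hfit' hfitO

end AllDoors

end Summit.HubbardSuperconductivity.HubbardSuperconductivity.Theorems.EngineV8

end
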